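import Mathlib
import Summits.QuantumAdvantage.QuantumAdvantage.Theses.MobiusLadder
import Summits.QuantumAdvantage.QuantumAdvantage.Theorems.MobiusLadderDigitPolyUniformityAutomaticBase
import Summits.QuantumAdvantage.QuantumAdvantage.Theorems.MobiusLadderDigitPolyUniformityBaseAdditiveAutomatic
import Literature.RingTheory.MvPolynomial.IteratedDerivations

/-!
# Crux `DigitPolyUniformity` (stmt-QuantumAdvantage-1392): block-diagonal (base-`2^b` additive)
# phases — the inner-product bent function — modulo Müllner 2017

Companion of `MobiusLadderDigitPolyUniformityAutomaticClasses.lean` (sliding-window block-additive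
phases, digit-sum class). Here the blocks are ALIGNED: fix a block length `b ≥ 1` and a block rule
`B ∈ 𝔽₂[y_0..y_{b−1}]` with `B(0) = 0`, and consider the `2^b`-ADDITIVE digital function
`c(N) = Σ_j B(d_j(N))`, `d_j(N) = (bit_{bj}(N), …, bit_{bj+b−1}(N))` the base-`2^b` digits. The
case `b = 2`, `B = y_0 y_1` is the INNER-PRODUCT bent function `x_0x_1 + x_2x_3 + ⋯` (the
Maiorana–McFarland form with the identity permutation; rank `n/2`, flat Walsh spectrum `2^{−n/2}`):
outside every spectral class of the tree and not a sliding-window form. Such `c` satisfies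
`c(4^i n + r) = c(n) + c(r)` (`r < 4^i`), so its phase is `2^b`-automatic
(`isAutomaticSeq_of_baseAdditive`), and Müllner's theorem in base `2^b`
(`digitPolyUniformity_automatic_base`, from the named fact
`Literature.NumberTheory.LFunctions.mullner_moebius_automatic`, Müllner 2017 Thm. 1.2) gives the
crux inequality for every `P ∈ 𝔽₂[x_0..x_{n−1}]` with these cube values — CONDITIONALLY on that
one named fact (`hM`).

* `digitPolyUniformity_blockDiagonal` — the class, in the crux's `MvPolynomial`/`testBit` form;
* `exists_blockDiagPoly` — such `P` exist with `deg P ≤ deg B` (inside the crux's degree range);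
* `digitPolyUniformity_innerProduct` — the instance `b = 2`, `B = y_0 y_1`.
-/

set_option linter.dupNamespace false -- D-0017: single-problem summit ⇒ `QuantumAdvantage.QuantumAdvantage` by design

noncomputable section

namespace Summit.QuantumAdvantage.QuantumAdvantage.Theorems.MobiusLadder

open Filter Finset
open Literature.NumberTheory.LFunctions (IsAutomaticSeq mullner_moebius_automatic)

namespace BlockDiagonal

/-! ### Aligned blocks above the top digit -/

/-- A bit of block `j` lies below `b(j+1)`: `b j + t < b (j + 1)` for `t < b`. [folklore] -/
theorem blockBit_lt {b j : ℕ} (t : Fin b) : b * j + t < b * (j + 1) := by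
  have := t.is_lt
  rw [mul_add_one]
  omega

/-- The block at position `j ≥ M` of an `N < 2^{bM}` reads `false`. [folklore] -/
theorem testBit_block_eq_false {b N M j : ℕ} (hN : N < 2 ^ (b * M)) (hj : M ≤ j) (t : Fin b) :
    N.testBit (b * j + t) = false := by
  refine Nat.testBit_eq_false_of_lt (lt_of_lt_of_le hN (Nat.pow_le_pow_right two_pos ?_))
  exact (Nat.mul_le_mul_left b hj).trans (Nat.le_add_right _ _)

/-- For a block rule `Q` with `Q(0,…,0) = 0`, the sum of `Q` over the blocks `j < M` does not depend
on `M` once `N < 2^{bM}`. [folklore] -/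
theorem sum_block_eq_of_lt {b : ℕ} (Q : (Fin b → Bool) → ZMod 2) (hQ : Q (fun _ => false) = 0)
    {N M M' : ℕ} (hM : N < 2 ^ (b * M)) (hM' : N < 2 ^ (b * M')) :
    ∑ j ∈ range M, Q (fun t : Fin b => N.testBit (b * j + t)) =
      ∑ j ∈ range M', Q (fun t : Fin b => N.testBit (b * j + t)) := by
  wlog hle : M ≤ M' generalizing M M'
  · exact (this hM' hM (le_of_not_ge hle)).symm
  rw [← Finset.sum_range_add_sum_Ico _ hle]
  conv_lhs => rw [← add_zero (∑ j ∈ range M, Q (fun t : Fin b => N.testBit (b * j + t)))]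
  congr 1
  refine (Finset.sum_eq_zero fun j hj => ?_).symm
  rw [Finset.mem_Ico] at hj
  have hw : (fun t : Fin b => N.testBit (b * j + t)) = fun _ => false :=
    funext fun t => testBit_block_eq_false hM hj.1 t
  rw [hw, hQ]

/-- `N < 2^N ≤ 2^{bN}` for `b ≥ 1`. [folklore] -/
theorem lt_two_pow_mul_self {b : ℕ} (hb : 1 ≤ b) (N : ℕ) : N < 2 ^ (b * N) :=
  lt_of_lt_of_le N.lt_two_pow_self (Nat.pow_le_pow_right two_pos (Nat.le_mul_of_pos_left N hb))

/-- **Additivity of aligned block sums along the base-`2^b` kernel.** With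
`c(N) = Σ_{j<N} Q(block_j N)` and `Q(0) = 0`: `c(2^{bi} n + r) = c(n) + c(r)` for `r < 2^{bi}` —
the blocks below `i` are those of `r`, the blocks from `i` on are those of `n`. [folklore] -/
theorem blockSum_add {b : ℕ} (hb : 1 ≤ b) (Q : (Fin b → Bool) → ZMod 2)
    (hQ : Q (fun _ => false) = 0) (c : ℕ → ZMod 2)
    (hc : ∀ N, c N = ∑ j ∈ range N, Q (fun t : Fin b => N.testBit (b * j + t)))
    {i n r : ℕ} (hr : r < 2 ^ (b * i)) :
    c (2 ^ (b * i) * n + r) = c n + c r := by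
  set X := 2 ^ (b * i) * n + r with hX
  -- `X < 2^{b(i+n)}`
  have hn : n < 2 ^ (b * n) := lt_two_pow_mul_self hb n
  have hXlt : X < 2 ^ (b * (i + n)) := by
    have h1 : 2 ^ (b * i) * n + r < 2 ^ (b * i) * (n + 1) := by rw [mul_add_one]; omega
    calc X < 2 ^ (b * i) * (n + 1) := h1
      _ ≤ 2 ^ (b * i) * 2 ^ (b * n) := Nat.mul_le_mul_left _ (Nat.succ_le_of_lt hn)
      _ = 2 ^ (b * (i + n)) := by rw [← pow_add, Nat.mul_add]
  -- digits of `X`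
  have hbit : ∀ j (t : Fin b), X.testBit (b * j + t) =
      if j < i then r.testBit (b * j + t) else n.testBit (b * (j - i) + t) := by
    intro j t
    rw [hX, Nat.testBit_two_pow_mul_add n hr]
    by_cases hji : j < i
    · have hlt : b * j + t < b * i :=
        lt_of_lt_of_le (blockBit_lt t) (Nat.mul_le_mul_left b (Nat.succ_le_of_lt hji))
      rw [if_pos hlt, if_pos hji]
    · obtain ⟨d, rfl⟩ := Nat.exists_eq_add_of_le (le_of_not_gt hji)
      have hge : ¬ b * (i + d) + t < b * i := by rw [Nat.mul_add]; omega
      rw [if_neg hge, if_neg hji, Nat.add_sub_cancel_left]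
      congr 1
      rw [Nat.mul_add]
      omega
  rw [hc X, sum_block_eq_of_lt Q hQ (lt_two_pow_mul_self hb X) hXlt,
    ← Finset.sum_range_add_sum_Ico _ (Nat.le_add_right i n), add_comm (c n) (c r)]
  congr 1
  · -- blocks below `i`: those of `r`
    rw [hc r, sum_block_eq_of_lt Q hQ (lt_two_pow_mul_self hb r) hr]
    refine Finset.sum_congr rfl fun j hj => ?_
    rw [Finset.mem_range] at hj
    congr 1
    funext t
    rw [hbit j t, if_pos hj]
  · -- blocks from `i` on: those of `n`
    rw [Finset.sum_Ico_eq_sum_range, Nat.add_sub_cancel_left, hc n]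
    refine Finset.sum_congr rfl fun j _ => ?_
    congr 1
    funext t
    rw [hbit (i + j) t, if_neg (by omega), Nat.add_sub_cancel_left]

end BlockDiagonal

open BlockDiagonal

/-- **The crux for block-diagonal (base-`2^b` additive) phases, modulo Müllner 2017.** Fix a block
length `b ≥ 1` and a block rule `B ∈ 𝔽₂[y_0..y_{b−1}]` with `B(0) = 0`. Assuming
`mullner_moebius_automatic`, for every `ε > 0`, eventually in `n`, every `P ∈ 𝔽₂[x_0..x_{n−1}]`
whose cube values are `Σ_{j<n} B(bit_{bj} N, …, bit_{bj+b−1} N)` (digits above `n − 1` read `0`)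
satisfies `|Σ_{N<2ⁿ} λ(N)(−1)^{P(bits N)}| ≤ ε 2ⁿ`. The case `b = 2`, `B = y_0y_1` is the
inner-product bent function (`digitPolyUniformity_innerProduct`). Via `isAutomaticSeq_of_baseAdditive`
(base `2^b`) and `digitPolyUniformity_automatic_base`. [cite: Mullner2017, Thm. 1.2] -/
theorem digitPolyUniformity_blockDiagonal :
    Literature.NumberTheory.LFunctions.mullner_moebius_automatic → ∀ b : ℕ, 1 ≤ b → ∀ B : MvPolynomial (Fin b) (ZMod 2), MvPolynomial.constantCoeff B = 0 → ∀ ε : ℝ, 0 < ε → ∀ᶠ n : ℕ in Filter.atTop, ∀ P : MvPolynomial (Fin n) (ZMod 2), (∀ N : ℕ, N < 2 ^ n → MvPolynomial.eval (fun i : Fin n => if Nat.testBit N i then (1 : ZMod 2) else 0) P = ∑ j ∈ Finset.range n, MvPolynomial.eval (fun t : Fin b => if Nat.testBit N (b * j + t) then (1 : ZMod 2) else 0) B) → |∑ N ∈ Finset.range (2 ^ n), ((ArithmeticFunction.liouville N : ℤ) : ℝ) * (if MvPolynomial.eval (fun i : Fin n => if Nat.testBit N i then (1 : ZMod 2) else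 0) P = 1 then (-1 : ℝ) else 1)| ≤ ε * (2 : ℝ) ^ n := by
  intro hM b hb B hB ε hε
  obtain ⟨Q, hQ⟩ : ∃ Q : (Fin b → Bool) → ZMod 2, ∀ w, Q w =
      MvPolynomial.eval (fun t : Fin b => if w t then (1 : ZMod 2) else 0) B := ⟨_, fun _ => rfl⟩
  have hQ0 : Q (fun _ => false) = 0 := by
    rw [hQ]
    simp only [Bool.false_eq_true, if_false]
    rw [MvPolynomial.eval_zero']
    exact hB
  obtain ⟨c, hc⟩ : ∃ c : ℕ → ZMod 2, ∀ N, c N =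
      ∑ j ∈ range N, Q (fun t : Fin b => N.testBit (b * j + t)) := ⟨_, fun _ => rfl⟩
  have hadd : ∀ i n r : ℕ, 1 ≤ i → r < (2 ^ b) ^ i → c ((2 ^ b) ^ i * n + r) = c n + c r := by
    intro i n r _ hr
    rw [← pow_mul] at hr ⊢
    exact blockSum_add hb Q hQ0 c hc hr
  have h2b : 2 ≤ 2 ^ b := by
    calc (2 : ℕ) = 2 ^ 1 := (pow_one 2).symm
      _ ≤ 2 ^ b := Nat.pow_le_pow_right two_pos hb
  obtain ⟨φ, hφ0⟩ : ∃ φ : ℕ → ℝ, ∀ N, φ N = if c N = 1 then -1 else 1 := ⟨_, fun _ => rfl⟩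
  have hφ : IsAutomaticSeq (2 ^ b) (fun N => (φ N : ℂ)) := by
    have h := isAutomaticSeq_of_baseAdditive (2 ^ b) h2b c hadd
      (fun z => if z = 1 then (-1 : ℂ) else 1)
    convert h using 2 with N
    rw [hφ0]
    split_ifs <;> simp
  filter_upwards [digitPolyUniformity_automatic_base hM (2 ^ b) h2b φ hφ ε hε] with n hn P hP
  have hsum : ∑ N ∈ range (2 ^ n), ((ArithmeticFunction.liouville N : ℤ) : ℝ) *
        (if MvPolynomial.eval (fun i : Fin n => if Nat.testBit N i then (1 : ZMod 2) else 0) P = 1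
          then (-1 : ℝ) else 1) =
      ∑ N ∈ range (2 ^ n), ((ArithmeticFunction.liouville N : ℤ) : ℝ) * φ N := by
    refine Finset.sum_congr rfl fun N hN => ?_
    rw [Finset.mem_range] at hN
    have hNb : N < 2 ^ (b * n) :=
      lt_of_lt_of_le hN (Nat.pow_le_pow_right two_pos (Nat.le_mul_of_pos_left n hb))
    rw [hP N hN, hφ0, hc N, sum_block_eq_of_lt Q hQ0 (lt_two_pow_mul_self hb N) hNb]
    simp only [hQ]
  rw [hsum]
  exact hn

/-- **Block-diagonal polynomials exist, with the degree of the block rule.** For every block rule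
`B ∈ 𝔽₂[y_0..y_{b−1}]` and every `n` there is `P ∈ 𝔽₂[x_0..x_{n−1}]` of total degree `≤ deg B`
whose cube values are `Σ_{j<n} B(bit_{bj} N, …, bit_{bj+b−1} N)`, namely
`P = Σ_{j<n} B(x_{bj}, …, x_{bj+b−1})` with `x_s := 0` for `s ≥ n`. [folklore] -/
theorem exists_blockDiagPoly :
    ∀ (b : ℕ) (B : MvPolynomial (Fin b) (ZMod 2)) (n : ℕ), ∃ P : MvPolynomial (Fin n) (ZMod 2), P.totalDegree ≤ B.totalDegree ∧ ∀ N : ℕ, N < 2 ^ n → MvPolynomial.eval (fun i : Fin n => if Nat.testBit N i then (1 : ZMod 2) else 0) P = ∑ j ∈ Finset.range n, MvPolynomial.eval (fun t : Fin b => if Nat.testBit N (b * j + t) then (1 : ZMod 2) else 0) B := by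
  intro b B n
  classical
  let f : ℕ → Fin b → MvPolynomial (Fin n) (ZMod 2) := fun j t =>
    if h : b * j + (t : ℕ) < n then MvPolynomial.X ⟨b * j + t, h⟩ else 0
  have hf : ∀ j t, (f j t).totalDegree ≤ 1 := by
    intro j t
    simp only [f]
    split_ifs
    · exact (MvPolynomial.totalDegree_X _).le
    · simp
  refine ⟨∑ j ∈ range n, MvPolynomial.aeval (f j) B, ?_, ?_⟩
  · refine MvPolynomial.totalDegree_finsetSum_le fun j _ => ?_
    exact Literature.RingTheory.MvPolynomial.totalDegree_aeval_le_of_le_one (f j) (hf j) B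
  · intro N hN
    rw [map_sum]
    refine Finset.sum_congr rfl fun j _ => ?_
    have key := MvPolynomial.aeval_bind₁
      (fun s : Fin n => if Nat.testBit N s then (1 : ZMod 2) else 0) (f j) B
    rw [← MvPolynomial.aeval_eq_bind₁, MvPolynomial.aeval_eq_eval, MvPolynomial.aeval_eq_eval]
      at key
    rw [key]
    have hfun : (fun t : Fin b => MvPolynomial.eval
          (fun s : Fin n => if Nat.testBit N s then (1 : ZMod 2) else 0) (f j t)) =
        fun t : Fin b => if Nat.testBit N (b * j + t) then (1 : ZMod 2) else 0 := by
      funext t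
      simp only [f]
      split_ifs with h hb hb'
      · rw [MvPolynomial.eval_X]
        exact if_pos hb
      · rw [MvPolynomial.eval_X]
        exact if_neg hb
      · exfalso
        have : N.testBit (b * j + t) = false :=
          Nat.testBit_eq_false_of_lt (lt_of_lt_of_le hN (Nat.pow_le_pow_right two_pos (by omega)))
        rw [this] at hb'
        exact Bool.false_ne_true hb'
      · simp
    rw [hfun]

/-- **The inner-product bent function, modulo Müllner 2017.** Assuming `mullner_moebius_automatic`,
for every `ε > 0`, eventually in `n`, every `P ∈ 𝔽₂[x_0..x_{n−1}]` whose cube values are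
`Σ_{j<n} bit_{2j}(N) bit_{2j+1}(N) mod 2` (e.g. `P = x_0x_1 + x_2x_3 + ⋯`, the Maiorana–McFarland
bent form with the identity permutation: rank `⌊n/2⌋`, all Walsh coefficients `±2^{−⌈n/2⌉…}`) has
`|Σ_{N<2ⁿ} λ(N)(−1)^{P(bits N)}| ≤ ε 2ⁿ`. Instance `b = 2`, `B = y_0 y_1` of
`digitPolyUniformity_blockDiagonal`. [cite: Mullner2017, Thm. 1.2] -/
theorem digitPolyUniformity_innerProduct :
    Literature.NumberTheory.LFunctions.mullner_moebius_automatic → ∀ ε : ℝ, 0 < ε → ∀ᶠ n : ℕ in Filter.atTop, ∀ P : MvPolynomial (Fin n) (ZMod 2), (∀ N : ℕ, N < 2 ^ n → MvPolynomial.eval (fun i : Fin n => if Nat.testBit N i then (1 : ZMod 2) else 0) P = ∑ j ∈ Finset.range n, (if Nat.testBit N (2 * j) then (1 : ZMod 2) else 0) * (if Nat.testBit N (2 * j + 1) then (1 : ZMod 2) else 0)) → |∑ N ∈ Finset.range (2 ^ n), ((ArithmeticFunction.liouville N : ℤ) : ℝ) * (if MvPolynomial.eval (fun i : Fin n => if Nat.testBit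 N i then (1 : ZMod 2) else 0) P = 1 then (-1 : ℝ) else 1)| ≤ ε * (2 : ℝ) ^ n := by
  intro hM ε hε
  have hB : MvPolynomial.constantCoeff
      (MvPolynomial.X (0 : Fin 2) * MvPolynomial.X (1 : Fin 2) : MvPolynomial (Fin 2) (ZMod 2)) = 0 := by
    simp
  filter_upwards [digitPolyUniformity_blockDiagonal hM 2 one_le_two _ hB ε hε] with n hn P hP
  refine hn P fun N hN => ?_
  rw [hP N hN]
  refine Finset.sum_congr rfl fun j _ => ?_
  simp only [map_mul, MvPolynomial.eval_X, Fin.val_zero, Fin.val_one, add_zero]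

end Summit.QuantumAdvantage.QuantumAdvantage.Theorems.MobiusLadder

end
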